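import Summits.BirchSwinnertonDyer.Rank1Residual.O5.HeegnerLogTransportThreeTwoSidedRow240930b1Models
import HarnessLib
import HarnessLib.Audit.Tags

/-!
# (t′) at `p = 3` — the TWO-SIDED END on its ROW OF RECORD `240930b1 ~ 26770a1` (`K = ℚ(√−551)`), ROW file (§4, §4b, §5):
# the twist `G^(−551)`, the conductor numerals / `klSet` units, and the row END `o5_index_unit_row240930b1`
# (o5-r2 GEN 27, part 25c; §§1–3 = the sibling MODELS file `O5/HeegnerLogTransportThreeTwoSidedRow240930b1Models.lean`)

HONEST FRAMING. Research route; **O5 ((t′): additive potentially-supersingular reduction at an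
anomalous prime) stays OPEN**; conditional on the displayed hypotheses; nothing booked; no
RESIDUAL-MAP mark, label, count or tier moves. This file contains NO new mathematics about (t′): it
instantiates the two-sided END `o5_index_unit_of_goodOrd_companion_cited_s0d_ladder` (part 25b) on ONE
pair of Cremona curves and discharges, by kernel computation (`decide +kernel` on integer / rational
certificates; no `native_decide`), every binder of that END which is a FINITE statement about the three
curves involved:
(the per-binder bullets for `W`, the PAIR and `G` are in the MODELS file's module text, VERBATIM; the `Gd` bullet, the honest STILL-DISPLAYS list,
the references and the provenance line follow here VERBATIM)

* `Gd = [1, −689, 0, −416540572, −3008438171584]`, a globally minimal model of the twist `G^(−551)`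
  (`(u, r, s, t) = (1, 0, ½, 0)` applied to the tree's `G.quadraticTwist (−551)`; additive `I₀*` at `19`
  (`c = 4`) and `29` (`c = 1`), `I₄`, `I₈`, `I₁` at `2, 5, 2677`; `∏ c_ℓ = 64`): `IsElliptic`,
  `IsGloballyMinimal`, `hGd`, `htamGd : 3 ∤ ∏ c_ℓ(Gd)` (bracket `{2}·{8}·{1,2,4}·{1,2,4}·{1}`), and
  `hd : d_K = −551 < −4`.

What the row END `o5_index_unit_row240930b1` STILL DISPLAYS (honest list): the published theorems BY
NAME (`hKL` Kriz–Li 1.16, `hYZ` Yan–Zhu 4.15 PUB*, `hW20`, `hmod`, `hGZK`, `hKoG`, `hGZG`); `hρ`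
(`ρ̄_{W,3}` onto; instrument); the Heegner / modular-parametrisation data over a field `K` with
`d_K = −551` and the non-torsion of the two Heegner points; the two sharp `3`-descents `hSelG`, `hSelGd`;
the Manin binders `hcD`, `hc3′` (Cremona: optimal, `c = 1`, EVIDENCE). Census support (EVIDENCE, never
a Literature fact): this is one of exactly three KL3 pairs on which all finitary binders of the two-sided
END hold (o5-r2 GEN 27 memo, FINDING B); BSD predicts `[W(K) : ℤ P_K]` prime to `3` here (`𝓛_E = 0`).

References: [cite: SilvermanAEC2009, III.2.3, VII.1 Remark 1.1, VII.5 Prop. 5.1 and VII.2.2]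
[cite: Silverman1994, IV.9.4, IV.10.2 and IV.11.1] [cite: Tate1975, §7] [cite: Kraus1989, Prop. 1 and Prop. 2]
[cite: SilvermanAEC2009, §C.16 (definition of L_v(T))]
[cite: CremonaAlgorithms1997, §3.2 and Table 1] [cite: KrizLi2019, Theorem 1.16 (arXiv:1609.06687v4 pp. 7-8)]
[cite: Fisher2012Hessian, Thm. 13.2 (n = 3)] [cite: KrausOesterle1992, Prop. 3 (i) ⇒ (iii) (pp. 262–263)]
[cite: GrossZagier1986, Thm. I.6.3] [cite: Kolyvagin1990, Thm. A]

Typed by `planner-b2b-bsdres-o5-r2-g27-0` (o5-r2 GEN 27, part 25c). Target path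
`O5/HeegnerLogTransportThreeTwoSidedRow240930b1.lean` (NEW leaf; imports part 25b, part 21 `…IsoCurrency` and five built
kernel-certificate modules). Nothing booked.

### cc-typer-5 GEN 20 (O5 §3.5 / O6 §3.4 typer of record) — by-name ask A-O5-G27-1 of o5-r2 GEN 27, HOME/INBOX.md l.14993: '… THEN 25c d313241b3ce88d9b →
`O5/HeegnerLogTransportThreeTwoSidedRow240930b1.lean` (needs 25b; three curve-model `def` ⇒ the kind the gate infers)'; memo `HOME/b2b-bsdres-o5-r2/gen27/O5-GEN27.md`
fb9f7e33bc3d18a4; order of record 25 (p361579) → 25b → 25c MODELS → 25c ROW.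

Source: `HOME/b2b-bsdres-o5-r2/gen27/lean/HeegnerLogTransportThreeTwoSidedRow240930b1.lean` sha16 `d313241b3ce88d9b` (528 l.; `gen27/SHA16.txt`; o5-r2's joint scratch
`gen27/lean/scratch/concat_25_25b_25c.lean` c4142ff08f30b651 farm rc 0 / 0 warn / 0 sorry, `#print axioms o5_index_unit_row240930b1` standard, dedup of 51 names clean),
re-hashed by the typer right before writing.  SPLIT (typer; 528 lines exceed the gate's 400-line `lint.size` for NEW files under `Rank1Residual/O5/` — cf. KL3 parts 18 and
24): 25c = TWO files, every declaration block byte-identical and in source order, SAME namespaces `…O5.HeegnerLogTransport[.KL3TwoSidedRows]` (every FQN is the source's);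
script `class-closure/typer-5/gen20/g27c_split.py`, anchors asserted:
  MODELS = `O5/HeegnerLogTransportThreeTwoSidedRow240930b1Models.lean` = source l.1–68 (imports + module text UNCHANGED — its §4/§4b/§5 matter describes the sibling ROW file) +
           this ¶ + l.69–306 (§1 the three Cremona models `W240930b1` / `G26770a1` / `Gd551` + `IsElliptic` / `IsGloballyMinimal` + integral models + `c₄`/`c₆`, §1b `hcong`
           UNCONDITIONAL from the X3E certificate (3213:1), u = 110592, §2 `hadd` / `htam`, §3 `htamG` / `hordG` / `nsCount G 3 = 5` / the unit-log ladder `Q₀ = (28,36)`,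
           `hmk`) + `end KL3TwoSidedRows` + `end …HeegnerLogTransport`; 3 `def` (curve literals) + instances ⇒ kind definition (the gate's async-audit lane, as parts 20b / 24 CERT);
  ROW    = `O5/HeegnerLogTransportThreeTwoSidedRow240930b1.lean` (the ASKED module name; holds the row END) = `import …Row240930b1Models` + a header assembled from source
           l.15–21 / 45–49 / 51–64 / 66–68 VERBATIM + this ¶ + source l.71–101 (`open`s, namespaces) + l.307–528 VERBATIM (§4 the twist `G^(−551)`: `hGd`, `htamGd`; §4b
           conductor numerals `conductorNorm ℤ = 240930 / 26770`, `a_ℓ = ±1` at the common bad primes, `hunitW` / `hunitG`; `end KL3TwoSidedRows`; §5 the row END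
           `o5_index_unit_row240930b1`); THEOREMS ONLY, kind proof.
  THIS file = ROW (MODELS = p362747, this seat, in the tree).
Checks by the typer before each proposal: DEDUP `lean search --decl` (none of the 51 names; the gate's statement-level dedup runs at dry-run); standalone farm `lean check`
on TREE imports (rc 0 / 0 warnings / 0 sorries; ROW after MODELS' olean — joint concat scratch meanwhile), `#print axioms` of `KL3TwoSidedRows.hmk_G26770a1` /
`o5_index_unit_row240930b1` standard, dry-run clean; imports in the tree: part 25b `…StepZeroEndTwoSidedCert` (this seat), part 20 `…IsoCurrency` p356385,
`SecondDescent.X10aPrimeTargetsKernelCertificates`, `Additive.X4ThreeResCertKernel`, `Additive.IntModelTamagawaCertificate`, `Additive.IntModelConductorCertificate`,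
`X11b.KrausMinimalityGeneralTwo`.  CONTENT LABELS (source, unchanged): 3 curve-literal `def`s + instances + theorems (`decide +kernel` / `norm_num`, no `native_decide`),
0 `@[conjecture]`, 0 Literature facts (net named-fact debt 0), no `sorry`; per-pair EVIDENCE made kernel-exact for ONE row; the row END stays CONDITIONAL on the displayed
published theorems BY NAME + `hρ` + Heegner data + the two 3-descents + Manin binders (the module text's honest list).  HONEST FRAMING (cell `b2b-bsdres`): research
route, lane CLASS-CLOSURE §3.5 O5; nothing booked, no mark / label / count / tier of `RESIDUAL-MAP.md` moves; census (FINDING A / B) = EVIDENCE, never a Literature fact;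
O5 OPEN.
-/

open scoped Classical

open WeierstrassCurve Literature.NumberTheory.EllipticCurves
  Literature.NumberTheory.EllipticCurves.ModularForms
  Literature.NumberTheory.EllipticCurves.Rank1Residual
  Literature.NumberTheory.EllipticCurves.Rank1Residual.Typed
open Literature.NumberTheory.EllipticCurves.Rank1Residual.X11RankOneCertificates (countPoints)
open Literature.NumberTheory.EllipticCurves.Fisher2012 (hesseC4three hesseC6three eval_hesseC4three eval_hesseC6three)
open Summit.BirchSwinnertonDyer.BirchSwinnertonDyer.Rank1Residual.IntModel (integralModelInt_eq_of_map_eq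
  hasMultiplicativeReductionAtPrime_of_intModel hasSplitMultiplicativeReductionAtPrime_of_intModel_of_root
  not_hasSplitMultiplicativeReductionAtPrime_of_intModel_of_noroot)
open Summit.BirchSwinnertonDyer.Rank1Residual.Supersingular
  (QStep ladderRunQ qScalar reductionPointCount_eq_of_intModel_countPoints)
open Summit.BirchSwinnertonDyer.Rank1Residual.Additive (addv_of_intModel)
open Summit.BirchSwinnertonDyer.Rank1Residual.Additive.IntModelTam
  (not_dvd_tamagawaProduct_of_intModel_of_rowCheck)
open Summit.BirchSwinnertonDyer.Rank1Residual.Additive.IntModelCond (conductorNorm_eq_of_intModel_of_certs_of_eq)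
open Summit.BirchSwinnertonDyer.BirchSwinnertonDyer.Rank2Observatory.Tam (TamLocal)
open Summit.BirchSwinnertonDyer.Rank1Residual.SecondDescent (goodOrd_of_intModel)
open Summit.BirchSwinnertonDyer.Rank1Residual.X11b
  (isGloballyMinimal_of_krausCriterion_support natCard_point_eq_countPoints)
open Summit.BirchSwinnertonDyer.Rank1Residual.Additive.LocalLog
open Summit.BirchSwinnertonDyer.Rank1Residual.X1.CongruenceTransfer (TorsionIso)
open Literature.NumberTheory.EllipticCurves.Fisher2012 (threeCongruent_of_hesseCertificate_unconditional)
open IsDedekindDomain (HeightOneSpectrum)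
open Rat.HeightOneSpectrum (primesEquiv)
open scoped NumberField

namespace Summit.BirchSwinnertonDyer.Rank1Residual.O5.HeegnerLogTransport

namespace KL3TwoSidedRows

/-! ### §4 The twist `G^(−551)`: `hGd`, `htamGd` in the kernel -/

/-- **`hGd` IN THE KERNEL**: `(u, r, s, t) = (1, 0, ½, 0)` carries the tree's model `26770a1.quadraticTwist (−551) =
⟨0, −551·b₂/4, 0, 551²·b₄/2, −551³·b₆/4⟩` (`b₂, b₄, b₆ = 5, −2744, 71936`) to `Gd551`. [cite: SilvermanAEC2009, III.1 and X.5.4] -/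
theorem twist_G26770a1_551 :
    ∃ C : VariableChange ℚ, C • G26770a1.quadraticTwist ((-551 : ℤ) : ℚ) = Gd551 :=
  ⟨⟨1, 0, (1 : ℚ) / 2, 0⟩, by
    ext <;> norm_num [WeierstrassCurve.variableChange_def, WeierstrassCurve.quadraticTwist, G26770a1, Gd551,
      WeierstrassCurve.b₂, WeierstrassCurve.b₄, WeierstrassCurve.b₆]⟩

/-- Stage-1 Tamagawa row certificate of `Gd551 = 26770a1^(−551)`: `2` `I₄` non-split (`2`), `5` `I₈` split (`8`), `19` `I₀*`
(deep certificate, `(r,s,t) = (0,9,0)`, `c = 4 ∈ {1,2,4}`), `29` `I₀*` (`(0,14,0)`, `c = 1 ∈ {1,2,4}`), `2677` `I₁` (`1`);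
`|Δ| = 2⁴·5⁸·19⁶·29⁶·2677`; engine `∏ c_ℓ = 64`. [cite: Silverman1994, IV.9.4] [cite: Tate1975, §7] -/
theorem rowCheck_Gd551 :
    TamLocal.rowCheck [⟨2, 1, 2, 0, 0, 0, 0, 4, 0, 0, 2⟩, ⟨5, 2, 1, 1, 0, 0, 0, 8, 0, 0, 8⟩,
        ⟨19, 4, 5, 0, 0, 9, 0, 6, 6, 0, 4⟩, ⟨29, 5, 5, 0, 0, 14, 0, 6, 6, 0, 1⟩,
        ⟨2677, 51, 1, 1876, 0, 0, 0, 1, 0, 0, 1⟩] ⟨1, -689, 0, -416540572, -3008438171584⟩ = true := by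
  decide +kernel

/-- **`htamGd` IN THE KERNEL**: `3 ∤ ∏_ℓ c_ℓ(Gd551)` (every value of the certified bracket `{2}·{8}·{1,2,4}·{1,2,4}·{1}` is a
power of `2`). [cite: Silverman1994, IV.9.4] [cite: Tate1975, §7] -/
theorem tam3_Gd551 : ¬ 3 ∣ Gd551.tamagawaProduct :=
  not_dvd_tamagawaProduct_of_intModel_of_rowCheck intModel_Gd551 rowCheck_Gd551 3 (by decide +kernel)

/-! ### §4b The pair's binders `hunitW`, `hunitG` in the kernel: conductor numerals, `a_ℓ = ±1` at the
common bad primes `2, 5, 2677`, hence `klSet ⊆ {3}` on both sides (the `klSet` units are VACUOUS off `3`) -/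

/-- **`a_p(W) = 1` from a root of the node-tangent quadratic** of the integral model mod a multiplicative prime `p`
(`p ∣ Δ(E₀)`, `p ∤ c₄(E₀)`): split multiplicative (`IntModel.hasSplitMultiplicativeReductionAtPrime_of_intModel_of_root`,
Silverman VII.5.1(b)) and the local factor `1 − T` (Silverman §C.16). [cite: SilvermanAEC2009, VII.5 Prop. 5.1(b) and §C.16] -/
theorem lFunction_prime_eq_one_of_intModel_of_root {W : WeierstrassCurve ℚ} [W.IsElliptic] [W.IsGloballyMinimal]
    {E₀ : WeierstrassCurve ℤ} (hI : integralModelInt W = E₀) (p : ℕ) [hp : Fact p.Prime]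
    (hΔ : (p : ℤ) ∣ E₀.Δ) (hc₄ : ¬ (p : ℤ) ∣ E₀.c₄)
    (hroot : ∃ t : ZMod p, (E₀.c₄ : ZMod p) * t ^ 2 + (E₀.a₁ * E₀.c₄ : ZMod p) * t
      - (54 * E₀.b₆ - 3 * E₀.b₂ * E₀.b₄ + E₀.a₂ * E₀.c₄ : ZMod p) = 0) :
    W.LFunction p = 1 := by
  have hs := hasSplitMultiplicativeReductionAtPrime_of_intModel_of_root hI p hΔ hc₄ hroot
  obtain ⟨v, hv⟩ : ∃ v : HeightOneSpectrum (𝓞 ℚ), primesEquiv v = ⟨p, hp.out⟩ :=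
    ⟨(primesEquiv (R := 𝓞 ℚ)).symm ⟨p, hp.out⟩, Equiv.apply_symm_apply _ _⟩
  have hvp : (primesEquiv v : ℕ) = p := by rw [hv]
  have h2 := hasSplitMultiplicativeReductionAtPrime_iff_hasSplitMultiplicativeReductionAt W v
  rw [hv] at h2
  have h1 := W.LFunction_apply_primesEquiv_of_hasSplitMultiplicativeReductionAt (h2.mp hs)
  rwa [hvp] at h1

/-- **`a_p(W) = −1` from root-freeness of the node-tangent quadratic** of the integral model mod a multiplicative
prime `p`: non-split multiplicative (`IntModel.not_hasSplitMultiplicativeReductionAtPrime_of_intModel_of_noroot`) and the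
local factor `1 + T`. [cite: SilvermanAEC2009, VII.5 Prop. 5.1(b) and §C.16] -/
theorem lFunction_prime_eq_neg_one_of_intModel_of_noroot {W : WeierstrassCurve ℚ} [W.IsElliptic]
    [W.IsGloballyMinimal] {E₀ : WeierstrassCurve ℤ} (hI : integralModelInt W = E₀) (p : ℕ) [hp : Fact p.Prime]
    (hΔ : (p : ℤ) ∣ E₀.Δ) (hc₄ : ¬ (p : ℤ) ∣ E₀.c₄)
    (hnoroot : ∀ t : ZMod p, (E₀.c₄ : ZMod p) * t ^ 2 + (E₀.a₁ * E₀.c₄ : ZMod p) * t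
      - (54 * E₀.b₆ - 3 * E₀.b₂ * E₀.b₄ + E₀.a₂ * E₀.c₄ : ZMod p) ≠ 0) :
    W.LFunction p = -1 := by
  have hm := hasMultiplicativeReductionAtPrime_of_intModel hI p hΔ hc₄
  have hns := not_hasSplitMultiplicativeReductionAtPrime_of_intModel_of_noroot hI p hΔ hc₄ hnoroot
  obtain ⟨v, hv⟩ : ∃ v : HeightOneSpectrum (𝓞 ℚ), primesEquiv v = ⟨p, hp.out⟩ :=
    ⟨(primesEquiv (R := 𝓞 ℚ)).symm ⟨p, hp.out⟩, Equiv.apply_symm_apply _ _⟩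
  have hvp : (primesEquiv v : ℕ) = p := by rw [hv]
  have h2 := hasSplitMultiplicativeReductionAtPrime_iff_hasSplitMultiplicativeReductionAt W v
  rw [hv] at h2
  have h3 := W.hasMultiplicativeReductionAtPrime_iff_hasMultiplicativeReductionAt_ringOfIntegers v
  rw [hv] at h3
  have h1 := W.LFunction_apply_primesEquiv_of_hasMultiplicativeReductionAt_of_not_split (h3.mp hm)
    (fun h ↦ hns (h2.mpr h))
  rwa [hvp] at h1

/-- **`N(240930b1) = 240930 = 2·3²·5·2677` as a KERNEL numeral** — NO named fact: the rank-2 observatory's conductor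
certificates checked by `decide +kernel` on the integral model (`Additive.IntModelCond.conductorNorm_eq_of_intModel_of_certs_of_eq`):
`RNCert3 = ⟨34, 0, 0, 9, 5, 6, [⟨5, 2, 2, 1, 1⟩, ⟨2677, 51, 1, 1, 1097⟩]⟩` (`5` split with node-tangent root `1`, `2677` split
with root `1097`), local Tate certificates `⟨1, …⟩` at `2` (multiplicative, `f₂ = 1`) and `⟨3, 4, 1, 25, 9, 9, 0⟩` at `3` (deep:
Kodaira `III*`, `f₃ = 9 + 1 − 8 = 2`, Ogg). Generator: `census/cond_certs.py` over the observatory's `tate_deep` and n1011-p18's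
`certs_lib` glue (unchanged). [cite: Silverman1994, IV.9.4, IV.10.2 and IV.11.1] [cite: CremonaAlgorithms1997, Table 1 (240930b1)] -/
theorem conductorNorm_W240930b1 : W240930b1.conductorNorm ℤ = 240930 :=
  conductorNorm_eq_of_intModel_of_certs_of_eq intModel_W240930b1
    (c := ⟨34, 0, 0, 9, 5, 6, [⟨5, 2, 2, 1, 1⟩, ⟨2677, 51, 1, 1, 1097⟩]⟩) (l₂ := ⟨1, 0, 0, 0, 0, 0, 0⟩)
    (l₃ := ⟨3, 4, 1, 25, 9, 9, 0⟩)
    (by decide +kernel) (by decide +kernel) (by decide +kernel) (by decide +kernel)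

/-- **`N(26770a1) = 26770 = 2·5·2677` as a KERNEL numeral** (semistable): `RNCert3 = ⟨4, 0, 0, 0, 0, 0, [⟨5, 2, 8, 1, 0⟩,
⟨2677, 51, 1, 1, 514⟩]⟩`, local certificates `⟨1, …⟩` at `2` (multiplicative) and `⟨0, …⟩` at `3` (good, `f₃ = 0`).
[cite: Silverman1994, IV.10.2 and IV.11.1] [cite: CremonaAlgorithms1997, Table 1 (26770a1)] -/
theorem conductorNorm_G26770a1 : G26770a1.conductorNorm ℤ = 26770 :=
  conductorNorm_eq_of_intModel_of_certs_of_eq intModel_G26770a1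
    (c := ⟨4, 0, 0, 0, 0, 0, [⟨5, 2, 8, 1, 0⟩, ⟨2677, 51, 1, 1, 514⟩]⟩) (l₂ := ⟨1, 0, 0, 0, 0, 0, 0⟩)
    (l₃ := ⟨0, 0, 0, 0, 0, 0, 0⟩)
    (by decide +kernel) (by decide +kernel) (by decide +kernel) (by decide +kernel)

/-- `5` is prime (instance for `ZMod 5` as a field; scoped to this namespace). [folklore] -/
scoped instance fact_prime_five : Fact (Nat.Prime 5) := ⟨by norm_num⟩

/-- `2677` is prime (instance for `ZMod 2677` as a field; scoped to this namespace). [folklore] -/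
scoped instance fact_prime_2677 : Fact (Nat.Prime 2677) := ⟨by norm_num⟩

/-- `a₂(240930b1) = −1` (`I₃₄` non-split: the node-tangent quadratic is root-free mod `2`). [cite: SilvermanAEC2009, §C.16] -/
theorem lFunction_W240930b1_2 : W240930b1.LFunction 2 = -1 :=
  lFunction_prime_eq_neg_one_of_intModel_of_noroot intModel_W240930b1 2 (by decide +kernel) (by decide +kernel)
    (by decide +kernel)

/-- `a₅(240930b1) = 1` (`I₂` split: root `1` mod `5`). [cite: SilvermanAEC2009, §C.16] -/
theorem lFunction_W240930b1_5 : W240930b1.LFunction 5 = 1 :=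
  lFunction_prime_eq_one_of_intModel_of_root intModel_W240930b1 5 (by decide +kernel) (by decide +kernel)
    ⟨1, by decide +kernel⟩

/-- `a₂₆₇₇(240930b1) = 1` (`I₁` split: root `1097` mod `2677`). [cite: SilvermanAEC2009, §C.16] -/
theorem lFunction_W240930b1_2677 : W240930b1.LFunction 2677 = 1 :=
  lFunction_prime_eq_one_of_intModel_of_root intModel_W240930b1 2677 (by decide +kernel) (by decide +kernel)
    ⟨1097, by decide +kernel⟩

/-- `a₂(26770a1) = −1` (`I₄` non-split). [cite: SilvermanAEC2009, §C.16] -/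
theorem lFunction_G26770a1_2 : G26770a1.LFunction 2 = -1 :=
  lFunction_prime_eq_neg_one_of_intModel_of_noroot intModel_G26770a1 2 (by decide +kernel) (by decide +kernel)
    (by decide +kernel)

/-- `a₅(26770a1) = 1` (`I₈` split: root `0` mod `5`). [cite: SilvermanAEC2009, §C.16] -/
theorem lFunction_G26770a1_5 : G26770a1.LFunction 5 = 1 :=
  lFunction_prime_eq_one_of_intModel_of_root intModel_G26770a1 5 (by decide +kernel) (by decide +kernel)
    ⟨0, by decide +kernel⟩

/-- `a₂₆₇₇(26770a1) = 1` (`I₁` split: root `514` mod `2677`). [cite: SilvermanAEC2009, §C.16] -/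
theorem lFunction_G26770a1_2677 : G26770a1.LFunction 2677 = 1 :=
  lFunction_prime_eq_one_of_intModel_of_root intModel_G26770a1 2677 (by decide +kernel) (by decide +kernel)
    ⟨514, by decide +kernel⟩

/-- The primes of `3·N·N′ = 2²·3³·5²·2677²` are `2, 3, 5, 2677`. [folklore] -/
theorem eq_of_prime_dvd_level {ℓ : ℕ} (hℓ : ℓ.Prime) (h : ℓ ∣ 3 * 240930 * 26770) :
    ℓ = 2 ∨ ℓ = 3 ∨ ℓ = 5 ∨ ℓ = 2677 := by
  have h' : ℓ ∣ 2 ^ 2 * 3 ^ 3 * 5 ^ 2 * 2677 ^ 2 := by norm_num at h ⊢; exact h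
  rcases (Nat.Prime.dvd_mul hℓ).mp h' with h1 | h1
  · rcases (Nat.Prime.dvd_mul hℓ).mp h1 with h2 | h2
    · rcases (Nat.Prime.dvd_mul hℓ).mp h2 with h4 | h4
      · exact Or.inl ((Nat.prime_dvd_prime_iff_eq hℓ Nat.prime_two).mp (hℓ.dvd_of_dvd_pow h4))
      · exact Or.inr (Or.inl ((Nat.prime_dvd_prime_iff_eq hℓ Nat.prime_three).mp (hℓ.dvd_of_dvd_pow h4)))
    · exact Or.inr (Or.inr (Or.inl ((Nat.prime_dvd_prime_iff_eq hℓ (by norm_num)).mp (hℓ.dvd_of_dvd_pow h2))))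
  · exact Or.inr (Or.inr (Or.inr ((Nat.prime_dvd_prime_iff_eq hℓ (by norm_num)).mp (hℓ.dvd_of_dvd_pow h1))))

/-- **`hunitW` for the row IN THE KERNEL** — vacuously: every prime `ℓ ≠ 3` of `3·N·N′` divides both conductors with
`a_ℓ(240930b1) = a_ℓ(26770a1)` (`−1, 1, 1` at `2, 5, 2677`), so Kriz–Li's depletion set is `klSet W G = {3}`.
[cite: KrizLi2019, Thm. 1.16 (the set `ℓ ∣ pNN′/M`)] -/
theorem hunitW_row240930b1 :
    ∀ ℓ ∈ klSet W240930b1 G26770a1, ℓ ≠ 3 → padicValInt 3 (nsCount W240930b1 ℓ) = 0 := by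
  intro ℓ hℓ h3
  exfalso
  rw [klSet, Finset.mem_filter, conductorNorm_W240930b1, conductorNorm_G26770a1] at hℓ
  obtain ⟨hmem, h⟩ := hℓ
  have hcases := eq_of_prime_dvd_level (Nat.prime_of_mem_primeFactors hmem) (Nat.dvd_of_mem_primeFactors hmem)
  rcases h with h | h
  · exact h3 h
  rcases hcases with rfl | rfl | rfl | rfl
  · exact h ⟨by norm_num, by norm_num, by rw [lFunction_W240930b1_2, lFunction_G26770a1_2]⟩
  · exact h3 rfl
  · exact h ⟨by norm_num, by norm_num, by rw [lFunction_W240930b1_5, lFunction_G26770a1_5]⟩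
  · exact h ⟨by norm_num, by norm_num, by rw [lFunction_W240930b1_2677, lFunction_G26770a1_2677]⟩

/-- **`hunitG` for the row IN THE KERNEL** (the same three common primes, roles swapped: `klSet G W = {3}`).
[cite: KrizLi2019, Thm. 1.16 (the set `ℓ ∣ pNN′/M`)] -/
theorem hunitG_row240930b1 :
    ∀ ℓ ∈ klSet G26770a1 W240930b1, ℓ ≠ 3 → padicValInt 3 (nsCount G26770a1 ℓ) = 0 := by
  intro ℓ hℓ h3
  exfalso
  rw [klSet, Finset.mem_filter, conductorNorm_W240930b1, conductorNorm_G26770a1] at hℓ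
  obtain ⟨hmem, h⟩ := hℓ
  have hcases := eq_of_prime_dvd_level (Nat.prime_of_mem_primeFactors hmem)
    (by have := Nat.dvd_of_mem_primeFactors hmem; norm_num at this ⊢; exact this)
  rcases h with h | h
  · exact h3 h
  rcases hcases with rfl | rfl | rfl | rfl
  · exact h ⟨by norm_num, by norm_num, by rw [lFunction_W240930b1_2, lFunction_G26770a1_2]⟩
  · exact h3 rfl
  · exact h ⟨by norm_num, by norm_num, by rw [lFunction_W240930b1_5, lFunction_G26770a1_5]⟩
  · exact h ⟨by norm_num, by norm_num, by rw [lFunction_W240930b1_2677, lFunction_G26770a1_2677]⟩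

end KL3TwoSidedRows

open KL3TwoSidedRows

/-! ### §5 The two-sided END on the row `240930b1 ~ 26770a1`, `d_K = −551` -/

/-- **THE TWO-SIDED END ON ITS ROW OF RECORD** — `o5_index_unit_of_goodOrd_companion_cited_s0d_ladder` (part 25b)
with `W := 240930b1`, `G := 26770a1`, `Gd := Gd551` and EVERY finitary binder DISCHARGED IN THE KERNEL (§§1–4:
`IsElliptic`, `IsGloballyMinimal` ×3, the mod-`3` congruence `hcong` (X3E certificate `(3213:1)`, `u = 110592`,
unconditional), `hadd`, `htam`, `htamG`, `hordG`, `htamGd`, `hGd`, `hd`, and the unit-log certificate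
`h₀, steps, hrun, hk, hx, hmk`). For EVERY imaginary quadratic field `K` with `d_K = −551` (`3` split, Heegner for
`N`, `N′`), every pair of modular parametrisations / Heegner data and both embeddings (the `klSet` units `hunitW`,
`hunitG` are now kernel theorems of §4b): `ρ̄_{W,3}` onto, Kolyvagin + Gross–Zagier for `G/K`, the
non-torsion of the two Heegner points, the two sharp `3`-descents of `G` and `Gd551`, the Manin binders and the
five published theorems BY NAME give `ord₃ [W(K) : ℤ P_K] = 0`. Conditional theorem; research route; O5 OPEN;
nothing booked. [cite: KrizLi2019, Theorem 1.16 (arXiv:1609.06687v4 pp. 7-8)] [cite: GrossZagier1986, Thm. I.6.3]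
[cite: Kolyvagin1990, Thm. A] [cite: YanZhu2026, Theorem 4.15] [cite: Fisher2012Hessian, Thm. 13.2 (n = 3)]
[cite: KrausOesterle1992, Prop. 3 (i) ⇒ (iii) (pp. 262–263)] [cite: SilvermanAEC2009, IV.6.4, VII.2.2 and X.5.4] -/
theorem o5_index_unit_row240930b1
    (hKL : KrizLi2019.thm116_padicLogHeegner_congruence)
    (hYZ : YanZhu2026.thm415_padicValRat_bsd_rank_le_one)
    (hW20 : Wuthrich2014.lemma20_surjective_threeAdic_of_semistable)
    (hmod : exists_isNewformOf) (hGZK : rank_eq_analyticRank_of_analyticRank_le_one)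
    (hρ : W240930b1.HasSurjectiveModNGaloisRep 3)
    {N N' : ℕ} [NeZero N] [NeZero N'] (D : ModularParametrizationData W240930b1 N)
    (D' : ModularParametrizationData G26770a1 N')
    (K : Type) [Field K] [NumberField K] (hK : IsImaginaryQuadratic K) (hdK : NumberField.discr K = -551)
    (hH : SatisfiesHeegnerHypothesis N K) (hH' : SatisfiesHeegnerHypothesis N' K)
    (h3K : SatisfiesHeegnerHypothesis 3 K)
    (hKoG : kolyvagin N' G26770a1 K) (hGZG : gross_zagier N' G26770a1 K)
    (H : HeegnerDatum N (NumberField.discr K)) (H' : HeegnerDatum N' (NumberField.discr K))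
    (ι : K →+* ℂ) (ι₃ : K →+* ℚ_[3])
    (P : (W240930b1.baseChange K).toAffine.Point) (P' : (G26770a1.baseChange K).toAffine.Point)
    (hP : WeierstrassCurve.Affine.Point.map ι.toRatAlgHom P = heegnerPointComplex D H)
    (hP' : WeierstrassCurve.Affine.Point.map ι.toRatAlgHom P' = heegnerPointComplex D' H')
    (hPinf : ¬ IsOfFinAddOrder P) (hP'inf : ¬ IsOfFinAddOrder P')
    (hSelG : Nat.card (G26770a1.selmerGroup (3 : ℤ)) = 3 ^ G26770a1.mordellWeilRank)
    (hSelGd : Nat.card (Gd551.selmerGroup (3 : ℤ)) = 3 ^ Gd551.mordellWeilRank)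
    (hcD : padicValInt 3 D.maninConstant = 0) (hc3' : ¬ ((3 : ℤ) ∣ D'.maninConstant)) :
    padicValNat 3 (AddSubgroup.zmultiples P).index = 0 :=
  o5_index_unit_of_goodOrd_companion_cited_s0d_ladder hKL hYZ hW20 hmod hGZK W240930b1 G26770a1
    isCongruentModThree_240930b1_26770a1 hρ
    addv3_W240930b1 hunitW_row240930b1 hunitG_row240930b1 tam3_W240930b1 tam3_G26770a1 goodOrd3_G26770a1 Gd551 tam3_Gd551 D D' K hK
    hH hH' h3K hKoG hGZG (by rw [hdK]; norm_num) (by rw [hdK]; exact twist_G26770a1_551) H H' ι ι₃ P P' hP hP'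
    hPinf hP'inf nonsingular_G26770a1_Q₀
    [⟨false, 10, 53, -339, 0, 0, 0⟩, ⟨true, -12, 25, -22, (58 : ℚ) / 3, (3052 : ℚ) / 9, (-172528 : ℚ) / 27⟩]
    ladder_G26770a1 (k := 1) one_pos padicValRat_x_five_Q₀ hmk_G26770a1 hSelG hSelGd hcD hc3'

end Summit.BirchSwinnertonDyer.Rank1Residual.O5.HeegnerLogTransport
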